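import Summits.CriticalPhenomena.CardyFormulaZ2.Theorems.CardyBoundaryCoulombGasBoundaryDefectGaussianRStubReferenceLimitPart1
import Summits.CriticalPhenomena.CardyFormulaZ2.Theorems.CardyBoundaryCoulombGasBoundaryDefectGaussianRStubReferenceLimitPart2
import Mathlib.Algebra.BigOperators.Group.Finset.Basic

/-!
# Stub `stub_referenceLimit` of line `rainbow-monomials-in-excursion-kernels` — Part 3:
# admissibility of well-separated leg insertions on the bottom side of a lattice box

Crux `BoundaryDefectGaussianR` (stmt-CriticalPhenomena-14132). For the collar model
`Literature.Probability.LatticeModels.CollarLegModel` on a box `V = [x0, x0 + W] × [y0, y0 + H] ∩ ℤ²`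
of positive height, leg-insertion data whose points (sources and sink) are distinct non-corner
vertices of the bottom side, pairwise at least `G ≥ sinkLegs` columns apart, is ADMISSIBLE
(`LegInsertionData.IsAdmissible`): every point is met by the boundary walk from the sink (Part 1:
the walk is the explicit tour of the box), no footprint overlaps the next insertion (Part 2: an
insertion of `L ≤ G` legs is realised within `G` darts), and the walk closes up — the final
level is `-sinkLegs + sinkLegs - Σ_sources legs = -sinkLegs` by the potential bookkeeping of
Part 2, its wiredness is the parity of the level, and nothing is pending.

Also here (used by Part 4): three rounding inequalities for real abscissae on a lattice of mesh `δ`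
(`floor_sub_floor_ge`, `floor_lt_natFloor`, `neg_natFloor_lt_floor`) and the elementary facts about
the rainbow insertion datum `⟨(univ.erase j).image p, legs, p j⟩` of an injective configuration
(nonempty sources, positive legs, sink not a source, `sinkLegs ≤ Σ L`).
-/

namespace Summit.CriticalPhenomena.CardyFormulaZ2.Cruxes.BoundaryDefectGaussianR.RainbowMonomialsInExcursionKernels

open Literature.Probability.LatticeModels Literature.Probability.LatticeModels.CollarLegModel

/-! ### The time at which the walk from `((x0 + c, y0), S)` meets the `S`-dart of `(x0 + a, y0)`:
`a - c` if `c ≤ a`, else `W - c + H + W + H + 4 + a` (pure arithmetic of these times) -/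

/-- The meeting time is less than the period. [folklore] -/
theorem boxTime_lt {W H c a : ℕ} (hc : c ≤ W) (ha : a ≤ W) :
    (if c ≤ a then a - c else W - c + H + W + H + 4 + a) < 2 * W + 2 * H + 4 := by
  split_ifs <;> omega

/-- An insertion of at most `G ≤ W` legs at column `a` (the sink's column `c`, or at least `G`
columns away from it) is realised before the walk ends. [folklore] -/
theorem boxTime_add_le {W H c G a : ℕ} (hGW : G ≤ W) (hc : c ≤ W) (ha : a ≤ W)
    (hca : a = c ∨ G + a ≤ c ∨ G + c ≤ a) :
    (if c ≤ a then a - c else W - c + H + W + H + 4 + a) + G ≤ 2 * W + 2 * H + 4 := by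
  split_ifs <;> omega

/-- Two insertion columns `a, b` at least `G ≤ W` apart are met at times at least `G` apart. [folklore] -/
theorem boxTime_gap {W H c G a b : ℕ} (hGW : G ≤ W) (hc : c ≤ W) (ha : a ≤ W) (hb : b ≤ W)
    (hab : G + a ≤ b ∨ G + b ≤ a)
    (hlt : (if c ≤ a then a - c else W - c + H + W + H + 4 + a) <
      (if c ≤ b then b - c else W - c + H + W + H + 4 + b)) :
    (if c ≤ a then a - c else W - c + H + W + H + 4 + a) + G ≤
      (if c ≤ b then b - c else W - c + H + W + H + 4 + b) := by
  split_ifs at hlt ⊢ <;> omega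

section Box

variable {V : Finset (ℤ × ℤ)} {x0 y0 : ℤ} {W H : ℕ}
  (hV : ∀ v : ℤ × ℤ, v ∈ V ↔ (x0 ≤ v.1 ∧ v.1 ≤ x0 + W) ∧ (y0 ≤ v.2 ∧ v.2 ≤ y0 + H))
include hV

/-- The walk from `((x0 + c, y0), S)` meets the `S`-dart of `(x0 + a, y0)` at the meeting time. [folklore] -/
theorem tour_boxTime {c a : ℕ} (hc : c ≤ W) (ha : a ≤ W) :
    (dsucc V)^[if c ≤ a then a - c else W - c + H + W + H + 4 + a] ((x0 + c, y0), 3) = ((x0 + a, y0), 3) := by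
  split_ifs with h
  · rw [tour_bottom hV hc (a - c) (by omega)]
    have : (x0 + c + ((a - c : ℕ) : ℤ)) = x0 + a := by push_cast [Nat.cast_sub h]; ring
    rw [this]
  · exact tour_bottom' hV hc a (by omega)

/-- The insertion met at a dart of the walk, for insertion points on the bottom side of a box:
the sink at its `S`-dart, a source at its `S`-dart, nothing elsewhere. [folklore] -/
theorem startAt_box (hH : 0 < H) (ι : LegInsertionData) {c : ℕ} (hc0 : 0 < c) (hcW : c < W)
    (hsk : ι.sink = (x0 + c, y0)) (hsrc : ∀ x ∈ ι.source, x.2 = y0 ∧ x0 < x.1 ∧ x.1 < x0 + W) (d : Dart) :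
    ι.startAt V d = if d = ((x0 + c, y0), 3) then some (ι.sinkLegs, 1)
      else if d.1 ∈ ι.source ∧ d.2 = 3 then some (ι.legs d.1, -1) else none := by
  obtain ⟨⟨a, b⟩, k⟩ := d
  unfold LegInsertionData.startAt
  rw [hsk, outDart_bottom hV hH (by omega) (by omega)]
  by_cases h1 : (((a, b), k) : Dart) = ((x0 + c, y0), 3)
  · rw [if_pos (by rw [h1]), if_pos h1]
  · rw [if_neg (fun h => h1 (Option.some.inj h).symm), if_neg h1]
    by_cases h2 : ((a, b) : ℤ × ℤ) ∈ ι.source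
    · obtain ⟨hb, ha0, haW⟩ := hsrc _ h2
      simp only at hb ha0 haW
      subst hb
      rw [outDart_bottom hV hH ha0 haW]
      by_cases hk : k = 3
      · subst hk; simp [h2]
      · have hne3 : ¬ (some (((a, b), 3) : Dart) = some ((a, b), k)) := fun h =>
          hk (Prod.ext_iff.1 (Option.some.inj h)).2.symm
        rw [if_neg (fun h => hne3 h.2), if_neg (fun h => hk h.2)]
    · rw [if_neg (fun h => h2 h.1), if_neg (fun h => h2 h.1)]

/-- **Admissibility on a box.** Leg-insertion data on a box of positive height whose points are
distinct non-corner bottom vertices pairwise at least `G ≥ sinkLegs` columns apart (at least one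
source, positive leg numbers, the sink not a source) is admissible. [folklore] -/
theorem isAdmissible_of_box (hH : 0 < H) (ι : LegInsertionData) {G : ℕ}
    (hne : ι.source.Nonempty) (hlegs : ∀ x ∈ ι.source, 1 ≤ ι.legs x) (hsink : ι.sink ∉ ι.source)
    (hG : ι.sinkLegs ≤ G)
    (hposn : ∀ x ∈ insert ι.sink ι.source, x.2 = y0 ∧ x0 < x.1 ∧ x.1 < x0 + W)
    (hsep : ∀ x ∈ insert ι.sink ι.source, ∀ x' ∈ insert ι.sink ι.source, x ≠ x' → (G : ℤ) ≤ |x.1 - x'.1|) :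
    ι.IsAdmissible V := by
  classical
  -- columns of the insertion points
  have hcol : ∀ x ∈ insert ι.sink ι.source, ∃ a : ℕ, 0 < a ∧ a < W ∧ x = (x0 + a, y0) := by
    intro x hx
    obtain ⟨h2, h0, hW⟩ := hposn x hx
    refine ⟨(x.1 - x0).toNat, by omega, by omega, ?_⟩
    ext
    · simp only; omega
    · exact h2
  obtain ⟨c, hc0, hcW, hsk⟩ := hcol ι.sink (Finset.mem_insert_self _ _)
  have hsrc : ∀ x ∈ ι.source, x.2 = y0 ∧ x0 < x.1 ∧ x.1 < x0 + W :=
    fun x hx => hposn x (Finset.mem_insert_of_mem hx)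
  have hout : outDart V ι.sink = some ((x0 + c, y0), 3) := by
    rw [hsk]; exact outDart_bottom hV hH (by omega) (by omega)
  have hlen := length_cycle_box hV hcW.le (y0 := y0)
  have hnodup := nodup_cycle_box hV hcW.le (y0 := y0)
  have hstart := startAt_box hV hH ι hc0 hcW hsk hsrc
  -- `G ≤ W`: two distinct insertion points fit in the bottom side
  obtain ⟨x₁, hx₁⟩ := hne
  have hGW : G ≤ W := by
    obtain ⟨a, ha0, haW, rfl⟩ := hcol x₁ (Finset.mem_insert_of_mem hx₁)
    have hne' : ι.sink ≠ (x0 + a, y0) := fun h => hsink (h ▸ hx₁)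
    have := hsep _ (Finset.mem_insert_self _ _) _ (Finset.mem_insert_of_mem hx₁) hne'
    rw [hsk] at this
    simp only at this
    rcases le_abs'.1 this with h | h <;> omega
  -- the dart at the meeting time of an insertion column
  have hget : ∀ a : ℕ, a ≤ W → ∀ (h : (if c ≤ a then a - c else W - c + H + W + H + 4 + a) <
      (cycle V ((x0 + ↑c, y0), 3)).length),
      (cycle V ((x0 + ↑c, y0), 3))[if c ≤ a then a - c else W - c + H + W + H + 4 + a] = ((x0 + a, y0), 3) := by
    intro a ha h
    simp only [cycle_box hV hcW.le, List.getElem_iterate]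
    exact tour_boxTime hV hcW.le ha
  -- a start dart is the `S`-dart of an insertion point, with at most `G` legs
  have hstart' : ∀ (d : Dart) (L : ℕ) (σ : ℤ), ι.startAt V d = some (L, σ) →
      ∃ a : ℕ, 0 < a ∧ a < W ∧ d = ((x0 + a, y0), 3) ∧ L ≤ G ∧ (a = c ∨ G + a ≤ c ∨ G + c ≤ a) ∧
        (x0 + (a : ℤ), y0) ∈ insert ι.sink ι.source := by
    intro d L σ hd
    rw [hstart] at hd
    split_ifs at hd with h1 h2
    · refine ⟨c, hc0, hcW, h1, ?_, Or.inl rfl, hsk ▸ Finset.mem_insert_self _ _⟩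
      have := (Prod.ext_iff.1 (Option.some.inj hd)).1
      simp only at this; omega
    · obtain ⟨a, ha0, haW, hda⟩ := hcol d.1 (Finset.mem_insert_of_mem h2.1)
      have hL : L = ι.legs d.1 := by
        have := (Prod.ext_iff.1 (Option.some.inj hd)).1; exact this.symm
      have hne' : ι.sink ≠ d.1 := fun h => hsink (h ▸ h2.1)
      have hs := hsep _ (Finset.mem_insert_self _ _) _ (Finset.mem_insert_of_mem h2.1) hne'
      rw [hsk, hda] at hs
      simp only at hs
      refine ⟨a, ha0, haW, ?_, ?_, ?_, hda ▸ Finset.mem_insert_of_mem h2.1⟩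
      · obtain ⟨⟨d1, d2⟩, k⟩ := d
        simp only at hda h2
        rw [hda, h2.2]
      · rw [hL]
        exact (Finset.single_le_sum (fun x _ => Nat.zero_le (ι.legs x)) h2.1).trans hG
      · right; rcases le_abs'.1 hs with h | h <;> omega
  -- footprints: every insertion started before time `T` among {meeting times, the period} ends by `T`
  have hfoot : ∀ (T : ℕ), (T = 2 * W + 2 * H + 4 ∨ ∃ b : ℕ, b ≤ W ∧ (∀ a : ℕ, a ≤ W →
        (x0 + (a : ℤ), y0) ∈ insert ι.sink ι.source → a ≠ b → G + a ≤ b ∨ G + b ≤ a) ∧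
        T = (if c ≤ b then b - c else W - c + H + W + H + 4 + b)) →
      ∀ (s : ℕ) (hs : s < T) (L : ℕ) (σ : ℤ), (hsl : s < (cycle V ((x0 + ↑c, y0), 3)).length) →
        ι.startAt V ((cycle V ((x0 + ↑c, y0), 3))[s]) = some (L, σ) → s + L ≤ T := by
    intro T hT s hs L σ hsl hd
    obtain ⟨a, ha0, haW, hda, hLG, hac, hmem⟩ := hstart' _ L σ hd
    have hsa : s = (if c ≤ a then a - c else W - c + H + W + H + 4 + a) := by
      have h2 := hget a haW.le (hlen ▸ boxTime_lt hcW.le haW.le)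
      rw [← hda] at h2
      exact (hnodup.getElem_inj_iff).1 h2.symm ▸ rfl
    rcases hT with rfl | ⟨b, hb, hbsep, rfl⟩
    · calc s + L ≤ s + G := by omega
        _ ≤ _ := hsa ▸ boxTime_add_le hGW hcW.le haW.le hac
    · have hab : a ≠ b := by rintro rfl; omega
      calc s + L ≤ s + G := by omega
        _ ≤ _ := hsa ▸ boxTime_gap hGW hcW.le haW.le hb (hbsep a haW.le hmem hab) (hsa ▸ hs)
  refine ⟨⟨x₁, hx₁⟩, hlegs, hsink, ?_, ?_, ?_⟩
  · -- every insertion point is a non-corner bottom vertex met by the walk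
    intro x hx
    obtain ⟨a, ha0, haW, rfl⟩ := hcol x hx
    refine ⟨bottom_mem_box hV (by omega) (by omega), card_neighbours_filter_bottom hV hH (by omega) (by omega), ?_⟩
    have ht : (if c ≤ a then a - c else W - c + H + W + H + 4 + a) < (cycle V ((x0 + ↑c, y0), 3)).length :=
      hlen ▸ boxTime_lt hcW.le haW.le
    exact ⟨_, (mem_walk_iff ι V hout).2 ⟨_, ht, rfl⟩, by rw [hget a haW.le ht]⟩
  · -- no footprint overlaps the next insertion
    intro e he hst
    obtain ⟨t, ht, rfl⟩ := (mem_walk_iff ι V hout).1 he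
    simp only at hst ⊢
    obtain ⟨⟨L, σ⟩, hd⟩ := Option.ne_none_iff_exists'.1 hst
    obtain ⟨b, hb0, hbW, hdb, -, -, hbmem⟩ := hstart' _ L σ hd
    have htb : t = (if c ≤ b then b - c else W - c + H + W + H + 4 + b) := by
      have h2 := hget b hbW.le (hlen ▸ boxTime_lt hcW.le hbW.le)
      rw [← hdb] at h2
      exact (hnodup.getElem_inj_iff).1 h2.symm ▸ rfl
    have hbsep : ∀ a : ℕ, a ≤ W → (x0 + (a : ℤ), y0) ∈ insert ι.sink ι.source → a ≠ b →
        G + a ≤ b ∨ G + b ≤ a := by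
      intro a ha hamem hab
      have := hsep _ hamem _ hbmem (by simp; omega)
      simp only at this
      rcases le_abs'.1 this with h | h <;> omega
    have := pending_foldl_le (ι.startAt V) ι.init rfl (cycle V ((x0 + ↑c, y0), 3)) t t ht.le
      (fun s hs L' σ' h => hfoot t (Or.inr ⟨b, hbW.le, hbsep, htb⟩) s hs L' σ' (by omega) h)
    omega
  · -- the walk closes up
    have hP : 0 < (cycle V ((x0 + ↑c, y0), 3)).length := by rw [hlen]; omega
    rw [getLast?_walk ι V hout hP, Option.map_some]
    have hpend : (List.foldl (fun s d => s.step (ι.startAt V d)) ι.init (cycle V ((x0 + ↑c, y0), 3))).pending = 0 := by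
      have := pending_foldl_le (ι.startAt V) ι.init rfl (cycle V ((x0 + ↑c, y0), 3)) (2 * W + 2 * H + 4)
        (cycle V ((x0 + ↑c, y0), 3)).length le_rfl
        (fun s hs L' σ' h => hfoot _ (Or.inl rfl) s (hlen ▸ hs) L' σ' hs h)
      rw [List.take_length] at this; omega
    -- every insertion is met with nothing pending (the previous item, at every start time)
    have hpend' : ∀ (s : ℕ) (hs : s < (cycle V ((x0 + ↑c, y0), 3)).length),
        ι.startAt V ((cycle V ((x0 + ↑c, y0), 3))[s]) ≠ none →
        (List.foldl (fun s d => s.step (ι.startAt V d)) ι.init ((cycle V ((x0 + ↑c, y0), 3)).take s)).pending = 0 := by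
      intro t ht hst
      obtain ⟨⟨L, σ⟩, hd⟩ := Option.ne_none_iff_exists'.1 hst
      obtain ⟨b, hb0, hbW, hdb, -, -, hbmem⟩ := hstart' _ L σ hd
      have htb : t = (if c ≤ b then b - c else W - c + H + W + H + 4 + b) := by
        have h2 := hget b hbW.le (hlen ▸ boxTime_lt hcW.le hbW.le)
        rw [← hdb] at h2
        exact (hnodup.getElem_inj_iff).1 h2.symm ▸ rfl
      have hbsep : ∀ a : ℕ, a ≤ W → (x0 + (a : ℤ), y0) ∈ insert ι.sink ι.source → a ≠ b →
          G + a ≤ b ∨ G + b ≤ a := by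
        intro a ha hamem hab
        have := hsep _ hamem _ hbmem (by simp; omega)
        simp only at this
        rcases le_abs'.1 this with h | h <;> omega
      have := pending_foldl_le (ι.startAt V) ι.init rfl (cycle V ((x0 + ↑c, y0), 3)) t t ht.le
        (fun s hs L' σ' h => hfoot t (Or.inr ⟨b, hbW.le, hbsep, htb⟩) s hs L' σ' (by omega) h)
      omega
    have hodd : ∀ d L σ, ι.startAt V d = some (L, σ) → σ % 2 = 1 := by
      intro d L σ hd
      rw [hstart] at hd
      split_ifs at hd with h1 h2
      · have := (Prod.ext_iff.1 (Option.some.inj hd)).2; simp only at this; omega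
      · have := (Prod.ext_iff.1 (Option.some.inj hd)).2; simp only at this; omega
    have hinit_w : ι.init.wired = true ↔ ι.init.level % 2 = 1 := by
      simp only [LegInsertionData.init, beq_iff_eq]; omega
    obtain ⟨hw, -, hpot⟩ := invariant_foldl (ι.startAt V) ι.init hinit_w (Or.inl rfl) hodd
      (cycle V ((x0 + ↑c, y0), 3)) _ le_rfl hpend'
    rw [List.take_length] at hw hpot
    rw [hpend] at hpot
    -- the contributions of the insertions add up to `sinkLegs - Σ_sources legs = 0`
    have hsum : ((cycle V ((x0 + ↑c, y0), 3)).map fun d => (ι.startAt V d).elim 0 fun q => q.2 * (q.1 : ℤ)).sum = 0 := by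
      rw [← List.sum_toFinset _ hnodup]
      have hsub : (insert ι.sink ι.source).image (fun x : ℤ × ℤ => ((x, 3) : Dart)) ⊆
          (cycle V ((x0 + ↑c, y0), 3)).toFinset := by
        intro d hd
        rw [Finset.mem_image] at hd
        obtain ⟨x, hx, rfl⟩ := hd
        obtain ⟨a, ha0, haW, rfl⟩ := hcol x hx
        rw [List.mem_toFinset, List.mem_iff_getElem]
        exact ⟨_, hlen ▸ boxTime_lt hcW.le haW.le, hget a haW.le _⟩
      rw [← Finset.sum_subset hsub]
      · rw [Finset.sum_image (fun x _ y _ h => by simpa using h), Finset.sum_insert hsink]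
        have h1 : ι.startAt V (ι.sink, 3) = some (ι.sinkLegs, 1) := by rw [hstart, if_pos (by rw [hsk])]
        have h2 : ∀ x ∈ ι.source, ι.startAt V (x, 3) = some (ι.legs x, -1) := by
          intro x hx
          have hxs : ((x, 3) : Dart) ≠ ((x0 + c, y0), 3) := by
            rw [← hsk]; intro h
            have hx1 : x = ι.sink := by simpa using (Prod.ext_iff.1 h).1
            exact hsink (hx1 ▸ hx)
          rw [hstart, if_neg hxs, if_pos ⟨hx, rfl⟩]
        rw [h1, Finset.sum_congr rfl fun x hx => by rw [h2 x hx]]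
        simp [LegInsertionData.sinkLegs]
      · intro d _ hd
        rw [hstart]
        split_ifs with h1 h2
        · exact absurd (Finset.mem_image.2 ⟨ι.sink, Finset.mem_insert_self _ _, by rw [hsk, h1]⟩) hd
        · refine absurd (Finset.mem_image.2 ⟨d.1, Finset.mem_insert_of_mem h2.1, ?_⟩) hd
          obtain ⟨d1, k⟩ := d
          simp only at h2 ⊢; rw [h2.2]
        · rfl
    rw [hsum] at hpot
    have hl0 : ι.init.level = -(ι.sinkLegs : ℤ) := rfl
    have hp0 : ι.init.pending = 0 := rfl
    rw [hl0, hp0] at hpot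
    simp only [Nat.cast_zero, mul_zero, add_zero] at hpot
    have hwired : (List.foldl (fun s d => s.step (ι.startAt V d)) ι.init (cycle V ((x0 + ↑c, y0), 3))).wired =
        (ι.sinkLegs % 2 == 1) := by
      rw [Bool.eq_iff_iff, hw, hpot, beq_iff_eq]; omega
    rw [hpot, hwired, hpend]

end Box

/-! ### Rounding real abscissae to a lattice of mesh `δ`: separation and distance to `±⌊1/δ⌋₊` -/

/-- **Separation of rounded points.** If `u' - u ≥ g` and `g/δ ≥ G + 1` then
`⌊u'/δ⌋ - ⌊u/δ⌋ ≥ G`. [folklore] -/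
theorem floor_sub_floor_ge {u u' g δ : ℝ} {G : ℕ} (hδ : 0 < δ) (hg : g ≤ u' - u) (hG : (G : ℝ) + 1 ≤ g / δ) :
    (G : ℤ) ≤ ⌊u' / δ⌋ - ⌊u / δ⌋ := by
  have h1 : (⌊u / δ⌋ : ℝ) ≤ u / δ := Int.floor_le _
  have h2 : u' / δ - 1 < ⌊u' / δ⌋ := Int.sub_one_lt_floor _
  have h3 : g / δ ≤ u' / δ - u / δ := by rw [← sub_div]; exact div_le_div_of_nonneg_right hg hδ.le
  have : (G : ℝ) < (⌊u' / δ⌋ : ℝ) - ⌊u / δ⌋ := by linarith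
  exact_mod_cast this.le

/-- Rounded marks stay off the right corner: `⌊x/δ⌋ < ⌊1/δ⌋₊` if `x ≤ 1 - g`, `1 ≤ g/δ`. [folklore] -/
theorem floor_lt_natFloor {x g δ : ℝ} (hδ : 0 < δ) (hx : x ≤ 1 - g) (hg : 1 ≤ g / δ) :
    ⌊x / δ⌋ < (⌊1 / δ⌋₊ : ℤ) := by
  rw [Int.natCast_floor_eq_floor (by positivity : (0 : ℝ) ≤ 1 / δ)]
  have h1 : (⌊x / δ⌋ : ℝ) ≤ x / δ := Int.floor_le _
  have h2 : 1 / δ - 1 < ⌊1 / δ⌋ := Int.sub_one_lt_floor _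
  have h3 : x / δ ≤ 1 / δ - g / δ := by rw [← sub_div]; exact div_le_div_of_nonneg_right hx hδ.le
  have : (⌊x / δ⌋ : ℝ) < ⌊1 / δ⌋ := by linarith
  exact_mod_cast this

/-- Rounded marks stay off the left corner: `-⌊1/δ⌋₊ < ⌊x/δ⌋` if `-1 + g ≤ x`, `2 ≤ g/δ`. [folklore] -/
theorem neg_natFloor_lt_floor {x g δ : ℝ} (hδ : 0 < δ) (hx : -1 + g ≤ x) (hg : 2 ≤ g / δ) :
    -(⌊1 / δ⌋₊ : ℤ) < ⌊x / δ⌋ := by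
  rw [Int.natCast_floor_eq_floor (by positivity : (0 : ℝ) ≤ 1 / δ)]
  have h1 : 1 / δ - 1 < ⌊1 / δ⌋ := Int.sub_one_lt_floor _
  have h2 : x / δ - 1 < ⌊x / δ⌋ := Int.sub_one_lt_floor _
  have h3 : -(1 / δ) + g / δ ≤ x / δ := by
    rw [← neg_div, ← add_div]; exact div_le_div_of_nonneg_right hx hδ.le
  have : (-⌊1 / δ⌋ : ℝ) < ⌊x / δ⌋ := by linarith
  exact_mod_cast this

/-! ### The rainbow insertion data of an injective configuration -/

section Rainbow

variable {k : ℕ} (L : Fin k → ℕ) (j : Fin k) (p : Fin k → ℤ × ℤ)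

/-- The sources of the rainbow data are nonempty as soon as there is an index other than the sink's. [folklore] -/
theorem rainbow_source_nonempty (hk : ∃ i, i ≠ j) : ((Finset.univ.erase j).image p).Nonempty := by
  obtain ⟨i, hi⟩ := hk
  exact ⟨p i, Finset.mem_image_of_mem p (Finset.mem_erase.2 ⟨hi, Finset.mem_univ i⟩)⟩

/-- Every source carries at least one leg if all `L i ≥ 1`, `i ≠ j`. [folklore] -/
theorem rainbow_legs_pos (hpos : ∀ i, i ≠ j → 1 ≤ L i) :
    ∀ x ∈ (Finset.univ.erase j).image p, 1 ≤ ∑ b ∈ (Finset.univ.erase j).filter (fun b => p b = x), L b := by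
  intro x hx
  obtain ⟨i, hi, rfl⟩ := Finset.mem_image.1 hx
  have hij : i ≠ j := (Finset.mem_erase.1 hi).1
  exact (hpos i hij).trans (Finset.single_le_sum (f := L) (fun _ _ => Nat.zero_le _) (Finset.mem_filter.2 ⟨hi, rfl⟩))

/-- The sink is not a source (injective configuration). [folklore] -/
theorem rainbow_sink_not_mem (hp : Function.Injective p) : p j ∉ (Finset.univ.erase j).image p := by
  intro h
  obtain ⟨i, hi, he⟩ := Finset.mem_image.1 h
  exact (Finset.mem_erase.1 hi).1 (hp he)

/-- The sink carries `Σ_{i ≠ j} L i ≤ Σ_i L i` legs. [folklore] -/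
theorem rainbow_sinkLegs_le :
    (⟨(Finset.univ.erase j).image p, fun v => ∑ b ∈ (Finset.univ.erase j).filter (fun b => p b = v), L b, p j⟩ :
      LegInsertionData).sinkLegs ≤ ∑ i, L i := by
  unfold LegInsertionData.sinkLegs
  simp only
  rw [Finset.sum_fiberwise_of_maps_to (fun i hi => Finset.mem_image_of_mem p hi)]
  exact Finset.sum_le_univ_sum_of_nonneg fun _ => Nat.zero_le _

/-- Every insertion point of the rainbow data is a configuration point. [folklore] -/
theorem rainbow_mem_insert {x : ℤ × ℤ} (hx : x ∈ insert (p j) ((Finset.univ.erase j).image p)) : ∃ i, x = p i := by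
  rcases Finset.mem_insert.1 hx with rfl | h
  · exact ⟨j, rfl⟩
  · obtain ⟨i, -, rfl⟩ := Finset.mem_image.1 h
    exact ⟨i, rfl⟩

end Rainbow

/-- **Sub-goal `s4_boxAdmissible` of stub 4** (registered on stmt-CriticalPhenomena-14132):
leg-insertion data on a lattice box of positive height whose points are distinct non-corner
vertices of the bottom side, pairwise at least `G ≥ sinkLegs` columns apart (at least one source,
positive leg numbers, the sink not a source), is admissible for the collar walk
(`isAdmissible_of_box`). [folklore] -/
theorem s4_boxAdmissible : ∀ (V : Finset (ℤ × ℤ)) (x0 y0 : ℤ) (W H G : ℕ) (ι : Literature.Probability.LatticeModels.CollarLegModel.LegInsertionData), (∀ v : ℤ × ℤ, v ∈ V ↔ (x0 ≤ v.1 ∧ v.1 ≤ x0 + W) ∧ (y0 ≤ v.2 ∧ v.2 ≤ y0 + H)) → 0 < H → ι.source.Nonempty → (∀ x ∈ ι.source, 1 ≤ ι.legs x) → ι.sink ∉ ι.source → ι.sinkLegs ≤ G → (∀ x ∈ insert ι.sink ι.source, x.2 = y0 ∧ x0 < x.1 ∧ x.1 < x0 + W) → (∀ x ∈ insert ι.sink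 ι.source, ∀ x' ∈ insert ι.sink ι.source, x ≠ x' → (G : ℤ) ≤ |x.1 - x'.1|) → ι.IsAdmissible V :=
  fun _ _ _ _ _ _ ι hV hH hne hlegs hsink hG hposn hsep => isAdmissible_of_box hV hH ι hne hlegs hsink hG hposn hsep

end Summit.CriticalPhenomena.CardyFormulaZ2.Cruxes.BoundaryDefectGaussianR.RainbowMonomialsInExcursionKernels
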